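import Summits.QuantumFields.BalabanUV.Beta.FP.TorusCompositeIndexWardOneSym
import Summits.QuantumFields.BalabanUV.Beta.FP.TorusCompositeCovarianceTwoStepSym
import Summits.QuantumFields.BalabanUV.Beta.FP.PeriodisedSymBorderT2IndexWardSnd

/-!
# `BalabanUV.Beta.FP.TorusCompositeIndexWardTwoSym` — row D1 ∕ (C1) OWNER an2 (gen 67) for the road «FP», ROUTE T, (β1) «sym» column: **(T-β-m) ORDER 2 AT EVERY
# DEPTH FOR THE (0.4)-SYMMETRISED TOWER, POLARISED — THE SYM COMPOSITE SECOND-ORDER INSERTION BI-JET WITH A TORUS PURE GAUGE IN ONE SLOT IS THE COMMUTATOR OF THE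
# SYM COMPOSITE FIRST-ORDER JET (ALONG THE OTHER SLOT) WITH THE DIAGONAL GAUGE GENERATORS**, `d + 1 = 4` — the (β1) twin of leaf-02 g26's ROOTED
# `FP/TorusCompositeIndexWardTwo` §1–§2, POLARISED for leaf-02's bilinear companion `compIns₂₂Sym` (`TorusCompositeCovarianceTwoPolarSym`)

WHY (an2 g66 J-NOTE-5, journal l.67629; road FP g42 LANDED-5 l.67649 «the composite order-2 sym shift law the road wants from an2's offered
`FP/TorusCompositeIndexWardTwoSym`»).  The END wrapper v4's 𝔔-side SECOND-order content row `hQN₂` reads the symmetrised conjugated bi-jet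
`½ • (𝔔′₂f v v′ + 𝔔′₂f v′ v)`; by J-NOTE-5 (a₂) `½ • (𝔔₂f v v′ + 𝔔₂f v′ v) = c² • compIns₂₂Sym … (n+2) (hv v) (hv v′)`, and with J-NOTE-4's instantiation
`Xbf v = c • diagonal (lv v ∘ itRoot^{ρ_c} (n+2) ∘ fst)`, `𝔔₁f v = c • compIns₁Sym … (hv v)`, `𝔔₀ = compRowsSym …`, the conjugation is `c² •` the sym composite
bi-jet at the SHIFTED pair `(hv v + tgrad·lv v, hv v′ + tgrad·lv v′)` — THIS FILE's `compIns₂₂Sym_pureGauge_shift` — so (E4e²) is F5-Sym + the `WN` double fold +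
the second-order lock rows, exactly as (E4e) was F4-Sym + PART 11 + `hcVH` one order down (road g42 #3∕#4).

WHAT (`d := 3` — leaf-02's sym order-2 bi-weighted forms (B1∕B2) `PeriodisedSymBorderT2IndexWardSnd.torus_symQ12_gauge_fst ∕ _snd` live at the record's dimension;
blocking `Lc`, `[NeZero Lc]`; the ONLY hypothesis is `hc : ctrOff (3+1) Lc ∈ box (3+1) Lc`, met by `ctrOff_mem_box` at `1 ≤ Lc`; [folklore] finite sums + matrix
algebra BY NAME over leaf-02∕leaf-06's typed sym objects `stepIns₁Sym ∕ stepIns₂₂Sym ∕ compIns₁Sym ∕ compIns₂₂Sym ∕ compIns₂Sym ∕ QstepSym ∕ compRowsSym ∕ rootPt ∕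
itRoot ∕ tgrad ∕ tdelta`; no `def`, no `def … : Prop`, nothing cited, 0 sorry).  Letters: `Dλ := fun b => Σ_s tgrad T (b.1, inl b.2) s · λ s` (a torus pure gauge on
the finest torus `T`), `E_λ := diagonal (λ b.1)` (a field leg rotates at the BASE of its bond), `R_λ := diagonal (λ (itRoot^{ρ_c} n a.1))` (a multiplier rotates at
the ITERATED CENTRED ROOT of its coarse site), `C := compRowsSym … n`, `I₁ h := compIns₁Sym … n h`.
§1 (one step, `F = fine Lc M`, centred root): `sum_tdelta_zsmul_add_ctr` (the multiplier rotates at `rootPt hc`), **`stepIns₂₂Sym_eq_neg_sum_borderT2`** (R-19's plain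
pair-symmetrised sym bi-jet IS MINUS leaf-02's (B1∕B2) bi-weighted form over an1's row table `symVh₂SAn1 3 Lc` — leaf-02 g32's sign bridge
`TorusCompositeCovarianceTwoStepSym.perF_dper_symPair_eq_neg`, entry by entry), **`stepIns₂₂Sym_gauge_fst ∕ _snd`**:
`stepIns₂₂Sym M Lc (Dλ) g = diagonal (λ (rootPt hc a.1)) * stepIns₁Sym M Lc g − stepIns₁Sym M Lc g * diagonal (λ c.1) = stepIns₂₂Sym M Lc g (Dλ)` — NO constants,
NO residual: the sym one-step bi-member is EXACTLY gauge-covariant in each slot (B1∕B2's two minus signs cancel against the bridge's).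
§2 (tower, push-inside types, g66's induction pattern): `compIns₂₂Sym_pureGauge_fst_step` and **`compIns₂₂Sym_pureGauge_fst`** (`compIns₂₂Sym … n (Dλ) h = R_λ * I₁ h − I₁ h * E_λ`
— at the induction step the top step's bi-jet along the transported gauge `C(Dλ) = σ_n • D(λ ∘ itRoot n)` meets `(θ_n∕σ_n)·σ_n = θ_n`, the top step's first jet along it
meets `θ_n·σ_n·c_{lev 1} = 1`, and the two `R_low`-terms cancel against the chain-rule summand and the rows-on-`ih` summand), **`compIns₂₂Sym_pureGauge_snd`** (by
`compIns₂₂Sym_comm`), **`compIns₂₂Sym_pureGauge_pureGauge`** (`compIns₂₂Sym … n (Dλ) (Dλ′) = R_λ * (R_λ′ * C − C * E_λ′) − (R_λ′ * C − C * E_λ′) * E_λ`, by g66's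
`compIns₁Sym_pureGauge_fun`), **`compIns₂₂Sym_pureGauge_shift`** (THE POLARISED SHIFT LAW: `compIns₂₂Sym … n (h + Dλ) (h′ + Dλ′) = compIns₂₂Sym … n h h′ +
(R_λ′ * I₁ h − I₁ h * E_λ′) + (R_λ * I₁ h′ − I₁ h′ * E_λ) + (R_λ * (R_λ′ * C − C * E_λ′) − (R_λ′ * C − C * E_λ′) * E_λ)`, by bilinearity `compIns₂₂Sym_add_left ∕ _right`),
and the DIAGONAL **`compIns₂Sym_pureGauge_shift`** — leaf-02 g26's rooted `compIns₂_pureGauge_shift` VERBATIM under the (β1) substitution: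
`compIns₂Sym … n (h + Dλ) = compIns₂Sym … n h + ((R_λ * I₁ h − I₁ h * E_λ) + (R_λ * I₁ h − I₁ h * E_λ)) + (R_λ * (R_λ * C − C * E_λ) − (R_λ * C − C * E_λ) * E_λ)`.
WHAT THIS IS NOT: not the door's `q2` letter (leaf-02's `torus_q2_sym_letter` is the TWO-STEP regrouping with the chain-rule table `Q₂₁` read at `(Q₁₁ h)·h` — its
displayed fluctuation-leg residual concerns THAT presentation, not OUR ♭ bi-jet, whose middle summand is bilinear in `(C h, I₁ h′)` and shifts exactly); not (E4e²);
not F5-Sym; not the `WN` double fold; no second-order lock row ruled; no row of the END wrapper discharged; nothing of the dictionary ∕ Bałaban's asserted, valued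
or discharged; 0 estimates; 0∕4 row-D1 binders (hW, hR, D1Tel, D1Rep); ROOT M‴ p325680 ∕ P5c ∕ D6 untouched; NOT (C1), NOT (L2′), NOT (T-ID), NOT SDF, NOT D1,
NEVER «G-an2-4 closed», NOT BetaPertH, NOT continuum, NOT Clay.

HONEST DEPENDENCY (page 1, mandatory): continuum YM on T⁴ ⇐ BetaPertH ∧ nine spine estimates (0/9 proved); BetaPertH ⇐ (D1) ∧ (D4) ∧ CAP+tail;
G-an2-4 gates asym, D1 and NE2/3/4.  HONEST FRAMING (cell contract, verbatim): «discharging `BetaPertH` makes Bałaban's UV stability UNCONDITIONAL —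
a real constructive-QFT result; it is NOT the continuum limit and NOT the Clay problem.»  ABSOLUTE RULE (cell charter, verbatim): «No internally-minted
statement may enter as a cited fact. Every hypothesis is either kernel-proved in this package or a verbatim quotation of a PUBLISHED theorem with page
reference. The manuscript(s) under audit are NOT citable for their own disputed steps — they are the thing under adjudication; programme-internal
(2001/route/tribunal) claims are never citable.»  Row D1 ∕ (C1) OWNER an2 (b2b-balaban-beta-an2) gen 67, 2026-08-27.  No existing file touched.
-/

noncomputable section

open scoped BigOperators

namespace Summit.QuantumFields.BalabanUV.Beta.FP.TorusCompositeIndexWardTwoSym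

open Matrix Finset
open Literature.MathematicalPhysics.QuantumFieldTheory
open Literature.MathematicalPhysics.QuantumFieldTheory.Balaban1983to89
open Literature.MathematicalPhysics.QuantumFieldTheory.Balaban1983to89.Beta
open ExpKernelCalculus (MKer)
open B4TorusKernel.MultiPeriod (translate)
open B5Prop11Plancherel (fine)
open B6Lemma24Torus (pbox)
open AffineAveraging (Site box toSite)
open AveragingContoursRooted (ctr ctrOff ctrOff_mem_box)
open OneStepResolventKernel (Fib)
open Summit.QuantumFields.BalabanUV.Beta.BorderedHessian (stepScale stepScale_ne_zero)
open Summit.QuantumFields.BalabanUV.Beta.SymAveragingHessianCounts (symVhSAt)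
open Summit.QuantumFields.BalabanUV.Beta.SymAveragingMixedJetTables (symVh₂SAt)
open Summit.QuantumFields.BalabanUV.Beta.SymSecondOrderTablesAn1 (symVh₂SAn1)
open Summit.QuantumFields.BalabanUV.Beta.FP.KernelPeriodisationFib (Idx perF)
open Summit.QuantumFields.BalabanUV.Beta.FP.KernelPeriodisationFibLoc (dper)
open Summit.QuantumFields.BalabanUV.Beta.FP.TorusGaugeCovariance (tdelta tgrad)
open Summit.QuantumFields.BalabanUV.Beta.FP.TorusGaugeCovariancePairing (wrapPt wrapPt_of_mem sum_tdelta_mul)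
open Summit.QuantumFields.BalabanUV.Beta.FP.TorusGaugeCovarianceCoarse (coarsePt coarsePt_coe)
open Summit.QuantumFields.BalabanUV.Beta.FP.TorusCompositeObjects
open Summit.QuantumFields.BalabanUV.Beta.FP.TorusCompositeObjectsG (QstepSym compRowsSym compRowsSym_succ compRowsSym_zero)
open Summit.QuantumFields.BalabanUV.Beta.FP.TorusCompositeCovariance (rootPt rootPt_coe itRoot itRoot_zero itRoot_succ)
open Summit.QuantumFields.BalabanUV.Beta.FP.TorusCompositeCovarianceOne (prod_stepScale_mul_card_ne_zero')
open Summit.QuantumFields.BalabanUV.Beta.FP.TorusStepInsertionSym (stepIns₁Sym)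
open Summit.QuantumFields.BalabanUV.Beta.FP.TorusStepInsertionSymTwo (stepIns₂₂Sym stepIns₂Sym)
open Summit.QuantumFields.BalabanUV.Beta.FP.TorusCompositeCovarianceOneSym (compIns₁Sym compIns₁Sym_zero compIns₁Sym_succ)
open Summit.QuantumFields.BalabanUV.Beta.FP.TorusCompositeCovarianceTwoPolarSym (stepIns₁Sym_add stepIns₁Sym_smul stepIns₂₂Sym_add_left
  stepIns₂₂Sym_smul_left stepIns₂₂Sym_add_right stepIns₂₂Sym_smul_right stepIns₂₂Sym_comm compIns₁Sym_add compIns₁Sym_smul compIns₂₂Sym compIns₂₂Sym_zero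
  compIns₂₂Sym_succ compIns₂₂Sym_comm compIns₂₂Sym_add_left compIns₂₂Sym_add_right compIns₂Sym)
open Summit.QuantumFields.BalabanUV.Beta.FP.TorusCompositeCovarianceTwoStepSym (perF_dper_symPair_eq_neg)
open Summit.QuantumFields.BalabanUV.Beta.FP.TorusCompositeIndexWardOneSym (stepIns₁Sym_pureGauge_fun compRowsSym_mulVec_tgrad_fun compIns₁Sym_pureGauge_fun)
open Summit.QuantumFields.BalabanUV.Beta.FP.PeriodisedSymBorderT2IndexWardSnd (torus_symQ12_gauge_fst torus_symQ12_gauge_snd)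

/-! ## §1 One step, centred root, `d + 1 = 4`: the sym second-order bi-jet with a torus pure gauge in one slot -/

section OneStep

variable (M : Fin (3 + 1) → ℕ) [∀ μ, NeZero (M μ)] (Lc : ℕ) [NeZero Lc]

/-- [folklore] in C1's slot maps the multiplier `a` rotates at the CENTRED ROOT `rootPt hc a.1` of its block:
`Σ_s tdelta F (Lc•a.1 + ρ_c) s · λ s = λ (rootPt hc a.1)` (`ctr (3+1) Lc = toSite (ctrOff (3+1) Lc)` and `rootPt_coe` by `rfl`; `sum_tdelta_mul`, `wrapPt_of_mem`). -/
theorem sum_tdelta_zsmul_add_ctr (hc : ctrOff (3 + 1) Lc ∈ box (3 + 1) Lc) (lam : ↥(pbox (fine Lc M)) → ℝ) (a : ↥(pbox M) × Fin (3 + 1)) :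
    ∑ s : ↥(pbox (fine Lc M)), tdelta (fine Lc M) ((Lc : ℤ) • (a.1 : Site (3 + 1)) + ctr (3 + 1) Lc) s * lam s = lam (rootPt M Lc hc a.1) := by
  rw [show (Lc : ℤ) • (a.1 : Site (3 + 1)) + ctr (3 + 1) Lc = ((rootPt M Lc hc a.1 : ↥(pbox (fine Lc M))) : Site (3 + 1)) from rfl,
    sum_tdelta_mul, wrapPt_of_mem]

/-- [folklore] **R-19's PLAIN PAIR-SYMMETRISED SYM BI-JET IS MINUS leaf-02's (B1∕B2) BI-WEIGHTED FORM OVER an1's ROW TABLE** (the second-bond-periodised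
bi-family `W κ′ u′ κ u := Σ'_n symVh₂SAn1 3 Lc κ u κ′ (u′ + F∘n)`, bound by `hW` as in `PeriodisedSymBorderT2IndexWard(Snd)`): for all weights `v, v′`,
`stepIns₂₂Sym M Lc v v′ = −Σ_b Σ_{b′} (v b · v′ b′) • (perF F (dper F (W b′.2 ↑b′.1 b.2 ↑b.1))).submatrix ((coarsePt, inr), (·, inl))` — leaf-02 g32's sign
bridge `perF_dper_symPair_eq_neg` on the `(inr, inl)` block, entry by entry (`packed anti-twin atw` flips that block's sign). -/
theorem stepIns₂₂Sym_eq_neg_sum_borderT2 {W : Fin (3 + 1) → Site (3 + 1) → Fin (3 + 1) → Site (3 + 1) → MKer (3 + 1) (Fib 3)}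
    (hW : W = fun κ' u' κ u x z a c => ∑' n : Site (3 + 1), symVh₂SAn1 3 Lc κ u κ' (translate (fine Lc M) u' n) x z a c)
    (v v' : ↥(pbox (fine Lc M)) × Fin (3 + 1) → ℝ) :
    stepIns₂₂Sym M Lc v v'
      = -∑ b : ↥(pbox (fine Lc M)) × Fin (3 + 1), ∑ b' : ↥(pbox (fine Lc M)) × Fin (3 + 1), (v b * v' b') •
          (perF (fine Lc M) (dper (fine Lc M) (W b'.2 (b'.1 : Site (3 + 1)) b.2 (b.1 : Site (3 + 1))))).submatrix
            (fun a : ↥(pbox M) × Fin (3 + 1) => ((coarsePt M Lc a.1, Sum.inr a.2) : Idx (fine Lc M) (Fib 3)))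
            (fun c : ↥(pbox (fine Lc M)) × Fin (3 + 1) => ((c.1, Sum.inl c.2) : Idx (fine Lc M) (Fib 3))) := by
  subst hW
  rw [stepIns₂₂Sym, ← Finset.sum_neg_distrib]
  refine Finset.sum_congr rfl fun b _ => ?_
  rw [← Finset.sum_neg_distrib]
  refine Finset.sum_congr rfl fun b' _ => ?_
  rw [← smul_neg]
  congr 1
  ext a c
  rw [Matrix.neg_apply, Matrix.submatrix_apply, Matrix.submatrix_apply]
  exact perF_dper_symPair_eq_neg Lc (fine Lc M) b b' (coarsePt M Lc a.1) c.1 a.2 c.2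

/-- [folklore] **`stepIns₂₂Sym_gauge_fst` — THE SYM ONE-STEP SECOND-ORDER BI-JET WITH A TORUS PURE GAUGE IN ITS FIRST SLOT IS THE COMMUTATOR OF THE SYM FIRST
JET ALONG THE OTHER SLOT WITH THE DIAGONAL GAUGE GENERATORS** (leaf-02's B2 `torus_symQ12_gauge_fst` through §1's sign bridge; the multiplier rotates at
`rootPt hc`): `stepIns₂₂Sym M Lc (Dλ) g = diagonal (λ (rootPt hc a.1)) * stepIns₁Sym M Lc g − stepIns₁Sym M Lc g * diagonal (λ c.1)` — NO constant, NO residual. -/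
theorem stepIns₂₂Sym_gauge_fst (hc : ctrOff (3 + 1) Lc ∈ box (3 + 1) Lc) (lam : ↥(pbox (fine Lc M)) → ℝ) (g : ↥(pbox (fine Lc M)) × Fin (3 + 1) → ℝ) :
    stepIns₂₂Sym M Lc (fun b : ↥(pbox (fine Lc M)) × Fin (3 + 1) => ∑ s : ↥(pbox (fine Lc M)), tgrad (fine Lc M) (b.1, Sum.inl b.2) s * lam s) g
      = Matrix.diagonal (fun a : ↥(pbox M) × Fin (3 + 1) => lam (rootPt M Lc hc a.1)) * stepIns₁Sym M Lc g
        - stepIns₁Sym M Lc g * Matrix.diagonal (fun c : ↥(pbox (fine Lc M)) × Fin (3 + 1) => lam c.1) := by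
  obtain ⟨W, hW⟩ : ∃ W : Fin (3 + 1) → Site (3 + 1) → Fin (3 + 1) → Site (3 + 1) → MKer (3 + 1) (Fib 3),
      W = fun κ' u' κ u x z a c => ∑' n : Site (3 + 1), symVh₂SAn1 3 Lc κ u κ' (translate (fine Lc M) u' n) x z a c := ⟨_, rfl⟩
  have hR : Matrix.diagonal (fun a : ↥(pbox M) × Fin (3 + 1) =>
        ∑ s : ↥(pbox (fine Lc M)), tdelta (fine Lc M) ((Lc : ℤ) • (a.1 : Site (3 + 1)) + ctr (3 + 1) Lc) s * lam s)
      = Matrix.diagonal (fun a : ↥(pbox M) × Fin (3 + 1) => lam (rootPt M Lc hc a.1)) :=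
    congrArg Matrix.diagonal (funext fun a => sum_tdelta_zsmul_add_ctr M Lc hc lam a)
  have hf := torus_symQ12_gauge_fst M hW g lam
  rw [stepIns₂₂Sym_eq_neg_sum_borderT2 M Lc hW, stepIns₁Sym, ← hR]
  exact (congrArg Neg.neg hf).trans (neg_neg _)

/-- [folklore] **`stepIns₂₂Sym_gauge_snd`** — the same with the pure gauge in the SECOND slot (by leaf-02's `stepIns₂₂Sym_comm` at the centred root). -/
theorem stepIns₂₂Sym_gauge_snd (hc : ctrOff (3 + 1) Lc ∈ box (3 + 1) Lc) (g : ↥(pbox (fine Lc M)) × Fin (3 + 1) → ℝ) (lam : ↥(pbox (fine Lc M)) → ℝ) :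
    stepIns₂₂Sym M Lc g (fun b : ↥(pbox (fine Lc M)) × Fin (3 + 1) => ∑ s : ↥(pbox (fine Lc M)), tgrad (fine Lc M) (b.1, Sum.inl b.2) s * lam s)
      = Matrix.diagonal (fun a : ↥(pbox M) × Fin (3 + 1) => lam (rootPt M Lc hc a.1)) * stepIns₁Sym M Lc g
        - stepIns₁Sym M Lc g * Matrix.diagonal (fun c : ↥(pbox (fine Lc M)) × Fin (3 + 1) => lam c.1) := by
  rw [stepIns₂₂Sym_comm M Lc hc, stepIns₂₂Sym_gauge_fst M Lc hc lam g]

end OneStep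

/-! ## §2 The sym composite second-order bi-jet with a torus pure gauge in one slot, at every depth; the polarised and the diagonal shift laws -/

section Tower

variable (Lc : ℕ) [NeZero Lc]

/-- [folklore] **(T-β-m)-Sym ORDER 2 POLARISED, THE INDUCTION STEP** (push-inside types; `compIns₂₂Sym … (n+1)`, `compIns₁Sym … (n+1)`, `itRoot … (n+1)` UNFOLDED
by `rfl`): given the lower tower's law (`ih`), the three ♭ summands at `(Dλ, h)` — the top step's bi-jet at the transported gauge `C(Dλ) = σ_n • D(λ ∘ itRoot n)`
(§1 `stepIns₂₂Sym_gauge_fst`, weight `(θ_n∕σ_n)·σ_n = θ_n`), the chain-rule summand (the top step's first jet along the transported gauge — g66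
`stepIns₁Sym_pureGauge_fun`, weight `θ_n·σ_n·c_{lev 1} = 1` — on the lower first jet, plus the top step's first jet along `C h` on the lower jet at the gauge — g66
`compIns₁Sym_pureGauge_fun`), and the top rows on `ih` — regroup to the depth-`(n+1)` law; the two `R_low`-terms cancel in pairs. -/
theorem compIns₂₂Sym_pureGauge_fst_step (hc : ctrOff (3 + 1) Lc ∈ box (3 + 1) Lc) (n : ℕ) (M : Fin (3 + 1) → ℕ) [∀ μ, NeZero (M μ)] (lev : ℕ → ℕ)
    (rs : ℕ → (Fin (3 + 1) → ℕ)) (lam : ↥(pbox (towerTorus Lc (fine Lc M) n)) → ℝ) (h : ↥(pbox (towerTorus Lc (fine Lc M) n)) × Fin (3 + 1) → ℝ)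
    (ih : compIns₂₂Sym Lc (fine Lc M) (fun k => lev (k + 1)) (fun k => rs (k + 1)) n
        (fun b : ↥(pbox (towerTorus Lc (fine Lc M) n)) × Fin (3 + 1) =>
          ∑ s : ↥(pbox (towerTorus Lc (fine Lc M) n)), tgrad (towerTorus Lc (fine Lc M) n) (b.1, Sum.inl b.2) s * lam s) h
      = Matrix.diagonal (fun a : ↥(pbox (fine Lc M)) × Fin (3 + 1) =>
            lam (itRoot Lc (fine Lc M) (fun _ => ctrOff (3 + 1) Lc) (fun _ => hc) n a.1))
          * compIns₁Sym Lc (fine Lc M) (fun k => lev (k + 1)) (fun k => rs (k + 1)) n h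
        - compIns₁Sym Lc (fine Lc M) (fun k => lev (k + 1)) (fun k => rs (k + 1)) n h
          * Matrix.diagonal (fun b : ↥(pbox (towerTorus Lc (fine Lc M) n)) × Fin (3 + 1) => lam b.1)) :
    ((((Lc : ℝ) ^ (3 + 1) * stepScale 3 Lc (lev 1)) * (∏ i ∈ range n, (stepScale 3 Lc (lev (i + 1 + 1)) * ((box (3 + 1) Lc).card : ℝ)))⁻¹)
          * (∏ i ∈ range n, (stepScale 3 Lc (lev (i + 1 + 1)) * ((box (3 + 1) Lc).card : ℝ)))⁻¹) •
          (stepIns₂₂Sym M Lc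
              (compRowsSym Lc (fine Lc M) (fun k => lev (k + 1)) (fun k => rs (k + 1)) n *ᵥ
                (fun b : ↥(pbox (towerTorus Lc (fine Lc M) n)) × Fin (3 + 1) =>
                  ∑ s : ↥(pbox (towerTorus Lc (fine Lc M) n)), tgrad (towerTorus Lc (fine Lc M) n) (b.1, Sum.inl b.2) s * lam s))
              (compRowsSym Lc (fine Lc M) (fun k => lev (k + 1)) (fun k => rs (k + 1)) n *ᵥ h)
            * compRowsSym Lc (fine Lc M) (fun k => lev (k + 1)) (fun k => rs (k + 1)) n)
        + (((Lc : ℝ) ^ (3 + 1) * stepScale 3 Lc (lev 1)) * (∏ i ∈ range n, (stepScale 3 Lc (lev (i + 1 + 1)) * ((box (3 + 1) Lc).card : ℝ)))⁻¹) •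
          (stepIns₁Sym M Lc
              (compRowsSym Lc (fine Lc M) (fun k => lev (k + 1)) (fun k => rs (k + 1)) n *ᵥ
                (fun b : ↥(pbox (towerTorus Lc (fine Lc M) n)) × Fin (3 + 1) =>
                  ∑ s : ↥(pbox (towerTorus Lc (fine Lc M) n)), tgrad (towerTorus Lc (fine Lc M) n) (b.1, Sum.inl b.2) s * lam s))
              * compIns₁Sym Lc (fine Lc M) (fun k => lev (k + 1)) (fun k => rs (k + 1)) n h
            + stepIns₁Sym M Lc (compRowsSym Lc (fine Lc M) (fun k => lev (k + 1)) (fun k => rs (k + 1)) n *ᵥ h)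
              * compIns₁Sym Lc (fine Lc M) (fun k => lev (k + 1)) (fun k => rs (k + 1)) n
                (fun b : ↥(pbox (towerTorus Lc (fine Lc M) n)) × Fin (3 + 1) =>
                  ∑ s : ↥(pbox (towerTorus Lc (fine Lc M) n)), tgrad (towerTorus Lc (fine Lc M) n) (b.1, Sum.inl b.2) s * lam s))
        + QstepSym Lc M (lev 1) * compIns₂₂Sym Lc (fine Lc M) (fun k => lev (k + 1)) (fun k => rs (k + 1)) n
            (fun b : ↥(pbox (towerTorus Lc (fine Lc M) n)) × Fin (3 + 1) =>
              ∑ s : ↥(pbox (towerTorus Lc (fine Lc M) n)), tgrad (towerTorus Lc (fine Lc M) n) (b.1, Sum.inl b.2) s * lam s) h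
      = Matrix.diagonal (fun a : ↥(pbox M) × Fin (3 + 1) =>
            lam (itRoot Lc (fine Lc M) (fun _ => ctrOff (3 + 1) Lc) (fun _ => hc) n (rootPt M Lc hc a.1)))
          * ((((Lc : ℝ) ^ (3 + 1) * stepScale 3 Lc (lev 1)) * (∏ i ∈ range n, (stepScale 3 Lc (lev (i + 1 + 1)) * ((box (3 + 1) Lc).card : ℝ)))⁻¹) •
                (stepIns₁Sym M Lc (compRowsSym Lc (fine Lc M) (fun k => lev (k + 1)) (fun k => rs (k + 1)) n *ᵥ h)
                  * compRowsSym Lc (fine Lc M) (fun k => lev (k + 1)) (fun k => rs (k + 1)) n)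
              + QstepSym Lc M (lev 1) * compIns₁Sym Lc (fine Lc M) (fun k => lev (k + 1)) (fun k => rs (k + 1)) n h)
        - ((((Lc : ℝ) ^ (3 + 1) * stepScale 3 Lc (lev 1)) * (∏ i ∈ range n, (stepScale 3 Lc (lev (i + 1 + 1)) * ((box (3 + 1) Lc).card : ℝ)))⁻¹) •
                (stepIns₁Sym M Lc (compRowsSym Lc (fine Lc M) (fun k => lev (k + 1)) (fun k => rs (k + 1)) n *ᵥ h)
                  * compRowsSym Lc (fine Lc M) (fun k => lev (k + 1)) (fun k => rs (k + 1)) n)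
              + QstepSym Lc M (lev 1) * compIns₁Sym Lc (fine Lc M) (fun k => lev (k + 1)) (fun k => rs (k + 1)) n h)
          * Matrix.diagonal (fun b : ↥(pbox (towerTorus Lc (fine Lc M) n)) × Fin (3 + 1) => lam b.1) := by
  have hB : (box (3 + 1) Lc).Nonempty := ⟨ctrOff (3 + 1) Lc, hc⟩
  have hσ : (∏ i ∈ range n, (stepScale 3 Lc (lev (i + 1 + 1)) * ((box (3 + 1) Lc).card : ℝ))) ≠ 0 :=
    prod_stepScale_mul_card_ne_zero' Lc hB (fun i => lev (i + 1 + 1)) n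
  have hA : ((Lc : ℝ) ^ (3 + 1) * stepScale 3 Lc (lev 1)) ≠ 0 := mul_ne_zero (pow_ne_zero _ (by exact_mod_cast NeZero.ne Lc)) (stepScale_ne_zero _)
  -- the transported gauge `C(Dλ) = σ_n • D(λ ∘ itRoot n)`; the top step's bi-jet and first jet along it; the lower first jet at the gauge; `ih`
  rw [compRowsSym_mulVec_tgrad_fun Lc hc n (fine Lc M) _ _ lam, stepIns₂₂Sym_smul_left, stepIns₁Sym_smul,
    stepIns₂₂Sym_gauge_fst M Lc hc (fun t => lam (itRoot Lc (fine Lc M) (fun _ => ctrOff (3 + 1) Lc) (fun _ => hc) n t))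
      (compRowsSym Lc (fine Lc M) (fun k => lev (k + 1)) (fun k => rs (k + 1)) n *ᵥ h),
    stepIns₁Sym_pureGauge_fun M Lc hc (lev 1) (fun t => lam (itRoot Lc (fine Lc M) (fun _ => ctrOff (3 + 1) Lc) (fun _ => hc) n t)),
    compIns₁Sym_pureGauge_fun Lc hc n (fine Lc M) (fun k => lev (k + 1)) (fun k => rs (k + 1)) lam, ih]
  generalize hAdef : ((Lc : ℝ) ^ (3 + 1) * stepScale 3 Lc (lev 1)) = A at hA ⊢
  generalize hSdef : (∏ i ∈ range n, (stepScale 3 Lc (lev (i + 1 + 1)) * ((box (3 + 1) Lc).card : ℝ))) = S at hσ ⊢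
  simp only [Matrix.add_mul, Matrix.mul_add, Matrix.sub_mul, Matrix.mul_sub, Matrix.smul_mul, Matrix.mul_smul, smul_add, smul_sub, smul_smul,
    Matrix.mul_assoc]
  match_scalars <;> field_simp <;> ring

/-- [folklore] **`compIns₂₂Sym_pureGauge_fst` — (T-β-m)-Sym ORDER 2, POLARISED: THE SYM COMPOSITE SECOND-ORDER BI-JET WITH A TORUS PURE GAUGE IN ITS FIRST SLOT IS
THE COMMUTATOR OF THE SYM COMPOSITE FIRST JET ALONG THE OTHER SLOT WITH THE DIAGONAL GAUGE GENERATORS**, at every depth: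
`compIns₂₂Sym … n (Dλ) h = diagonal (λ (itRoot^{ρ_c} n a.1)) * compIns₁Sym … n h − compIns₁Sym … n h * diagonal (λ b.1)` — NO constants survive
(fields: `λ` at the base of their bond on the finest torus; multipliers: `λ` at the ITERATED CENTRED ROOT of their coarse site).  Depth `0`: `0 = 0`. -/
theorem compIns₂₂Sym_pureGauge_fst (hc : ctrOff (3 + 1) Lc ∈ box (3 + 1) Lc) :
    ∀ (n : ℕ) (M : Fin (3 + 1) → ℕ) [∀ μ, NeZero (M μ)] (lev : ℕ → ℕ) (rs : ℕ → (Fin (3 + 1) → ℕ))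
      (lam : ↥(pbox (towerTorus Lc M n)) → ℝ) (h : ↥(pbox (towerTorus Lc M n)) × Fin (3 + 1) → ℝ),
      compIns₂₂Sym Lc M lev rs n (fun b : ↥(pbox (towerTorus Lc M n)) × Fin (3 + 1) =>
          ∑ s : ↥(pbox (towerTorus Lc M n)), tgrad (towerTorus Lc M n) (b.1, Sum.inl b.2) s * lam s) h
        = Matrix.diagonal (fun a : ↥(pbox M) × Fin (3 + 1) => lam (itRoot Lc M (fun _ => ctrOff (3 + 1) Lc) (fun _ => hc) n a.1))
            * compIns₁Sym Lc M lev rs n h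
          - compIns₁Sym Lc M lev rs n h * Matrix.diagonal (fun b : ↥(pbox (towerTorus Lc M n)) × Fin (3 + 1) => lam b.1)
  | 0, M, _, lev, rs, lam, h => by
    simp only [compIns₂₂Sym_zero, compIns₁Sym_zero, Matrix.mul_zero, Matrix.zero_mul, sub_self]
  | n + 1, M, _, lev, rs, lam, h =>
    compIns₂₂Sym_pureGauge_fst_step Lc hc n M lev rs lam h
      (compIns₂₂Sym_pureGauge_fst hc n (fine Lc M) (fun k => lev (k + 1)) (fun k => rs (k + 1)) lam h)

/-- [folklore] **`compIns₂₂Sym_pureGauge_snd`** — the same with the pure gauge in the SECOND slot (leaf-02's `compIns₂₂Sym_comm` at the centred root). -/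
theorem compIns₂₂Sym_pureGauge_snd (hc : ctrOff (3 + 1) Lc ∈ box (3 + 1) Lc) (n : ℕ) (M : Fin (3 + 1) → ℕ) [∀ μ, NeZero (M μ)] (lev : ℕ → ℕ)
    (rs : ℕ → (Fin (3 + 1) → ℕ)) (h : ↥(pbox (towerTorus Lc M n)) × Fin (3 + 1) → ℝ) (lam : ↥(pbox (towerTorus Lc M n)) → ℝ) :
    compIns₂₂Sym Lc M lev rs n h (fun b : ↥(pbox (towerTorus Lc M n)) × Fin (3 + 1) =>
        ∑ s : ↥(pbox (towerTorus Lc M n)), tgrad (towerTorus Lc M n) (b.1, Sum.inl b.2) s * lam s)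
      = Matrix.diagonal (fun a : ↥(pbox M) × Fin (3 + 1) => lam (itRoot Lc M (fun _ => ctrOff (3 + 1) Lc) (fun _ => hc) n a.1))
          * compIns₁Sym Lc M lev rs n h
        - compIns₁Sym Lc M lev rs n h * Matrix.diagonal (fun b : ↥(pbox (towerTorus Lc M n)) × Fin (3 + 1) => lam b.1) := by
  rw [compIns₂₂Sym_comm Lc hc, compIns₂₂Sym_pureGauge_fst Lc hc]

/-- [folklore] **`compIns₂₂Sym_pureGauge_pureGauge` — THE SYM COMPOSITE BI-JET AT TWO TORUS PURE GAUGES**: `compIns₂₂Sym … n (Dλ) (Dλ′) =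
R_λ * (R_λ′ * C − C * E_λ′) − (R_λ′ * C − C * E_λ′) * E_λ` (`C = compRowsSym … n`; §2 `_fst` + g66 `compIns₁Sym_pureGauge_fun`). -/
theorem compIns₂₂Sym_pureGauge_pureGauge (hc : ctrOff (3 + 1) Lc ∈ box (3 + 1) Lc) (n : ℕ) (M : Fin (3 + 1) → ℕ) [∀ μ, NeZero (M μ)] (lev : ℕ → ℕ)
    (rs : ℕ → (Fin (3 + 1) → ℕ)) (lam lam' : ↥(pbox (towerTorus Lc M n)) → ℝ) :
    compIns₂₂Sym Lc M lev rs n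
        (fun b : ↥(pbox (towerTorus Lc M n)) × Fin (3 + 1) => ∑ s : ↥(pbox (towerTorus Lc M n)), tgrad (towerTorus Lc M n) (b.1, Sum.inl b.2) s * lam s)
        (fun b : ↥(pbox (towerTorus Lc M n)) × Fin (3 + 1) => ∑ s : ↥(pbox (towerTorus Lc M n)), tgrad (towerTorus Lc M n) (b.1, Sum.inl b.2) s * lam' s)
      = Matrix.diagonal (fun a : ↥(pbox M) × Fin (3 + 1) => lam (itRoot Lc M (fun _ => ctrOff (3 + 1) Lc) (fun _ => hc) n a.1))
          * (Matrix.diagonal (fun a : ↥(pbox M) × Fin (3 + 1) => lam' (itRoot Lc M (fun _ => ctrOff (3 + 1) Lc) (fun _ => hc) n a.1))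
              * compRowsSym Lc M lev rs n
            - compRowsSym Lc M lev rs n * Matrix.diagonal (fun b : ↥(pbox (towerTorus Lc M n)) × Fin (3 + 1) => lam' b.1))
        - (Matrix.diagonal (fun a : ↥(pbox M) × Fin (3 + 1) => lam' (itRoot Lc M (fun _ => ctrOff (3 + 1) Lc) (fun _ => hc) n a.1))
              * compRowsSym Lc M lev rs n
            - compRowsSym Lc M lev rs n * Matrix.diagonal (fun b : ↥(pbox (towerTorus Lc M n)) × Fin (3 + 1) => lam' b.1))
          * Matrix.diagonal (fun b : ↥(pbox (towerTorus Lc M n)) × Fin (3 + 1) => lam b.1) := by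
  rw [compIns₂₂Sym_pureGauge_fst Lc hc, compIns₁Sym_pureGauge_fun Lc hc]

/-- [folklore] **`compIns₂₂Sym_pureGauge_shift` — (T-β-m)-Sym ORDER 2, THE POLARISED SHIFT LAW AT EVERY DEPTH**: for all weights `h, h′` and torus gauge functions
`λ, λ′` on the finest torus,
`compIns₂₂Sym … n (h + Dλ) (h′ + Dλ′) = compIns₂₂Sym … n h h′ + (R_λ′ * I₁ h − I₁ h * E_λ′) + (R_λ * I₁ h′ − I₁ h′ * E_λ) + (R_λ * (R_λ′ * C − C * E_λ′) − (R_λ′ * C − C * E_λ′) * E_λ)`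
(`I₁ := compIns₁Sym … n`, `C := compRowsSym … n`; bilinearity `compIns₂₂Sym_add_left ∕ _add_right` and §2's three laws) — what the END wrapper's symmetrised
`½ • (𝔔′₂f v v′ + 𝔔′₂f v′ v)` reads at `h := hv v`, `λ := lv v` under J-NOTE-4's `Xbf`. -/
theorem compIns₂₂Sym_pureGauge_shift (hc : ctrOff (3 + 1) Lc ∈ box (3 + 1) Lc) (n : ℕ) (M : Fin (3 + 1) → ℕ) [∀ μ, NeZero (M μ)] (lev : ℕ → ℕ)
    (rs : ℕ → (Fin (3 + 1) → ℕ)) (h h' : ↥(pbox (towerTorus Lc M n)) × Fin (3 + 1) → ℝ) (lam lam' : ↥(pbox (towerTorus Lc M n)) → ℝ) :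
    compIns₂₂Sym Lc M lev rs n
        (fun b : ↥(pbox (towerTorus Lc M n)) × Fin (3 + 1) =>
          h b + ∑ s : ↥(pbox (towerTorus Lc M n)), tgrad (towerTorus Lc M n) (b.1, Sum.inl b.2) s * lam s)
        (fun b : ↥(pbox (towerTorus Lc M n)) × Fin (3 + 1) =>
          h' b + ∑ s : ↥(pbox (towerTorus Lc M n)), tgrad (towerTorus Lc M n) (b.1, Sum.inl b.2) s * lam' s)
      = compIns₂₂Sym Lc M lev rs n h h'
        + (Matrix.diagonal (fun a : ↥(pbox M) × Fin (3 + 1) => lam' (itRoot Lc M (fun _ => ctrOff (3 + 1) Lc) (fun _ => hc) n a.1))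
              * compIns₁Sym Lc M lev rs n h
            - compIns₁Sym Lc M lev rs n h * Matrix.diagonal (fun b : ↥(pbox (towerTorus Lc M n)) × Fin (3 + 1) => lam' b.1))
        + (Matrix.diagonal (fun a : ↥(pbox M) × Fin (3 + 1) => lam (itRoot Lc M (fun _ => ctrOff (3 + 1) Lc) (fun _ => hc) n a.1))
              * compIns₁Sym Lc M lev rs n h'
            - compIns₁Sym Lc M lev rs n h' * Matrix.diagonal (fun b : ↥(pbox (towerTorus Lc M n)) × Fin (3 + 1) => lam b.1))
        + (Matrix.diagonal (fun a : ↥(pbox M) × Fin (3 + 1) => lam (itRoot Lc M (fun _ => ctrOff (3 + 1) Lc) (fun _ => hc) n a.1))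
              * (Matrix.diagonal (fun a : ↥(pbox M) × Fin (3 + 1) => lam' (itRoot Lc M (fun _ => ctrOff (3 + 1) Lc) (fun _ => hc) n a.1))
                  * compRowsSym Lc M lev rs n
                - compRowsSym Lc M lev rs n * Matrix.diagonal (fun b : ↥(pbox (towerTorus Lc M n)) × Fin (3 + 1) => lam' b.1))
            - (Matrix.diagonal (fun a : ↥(pbox M) × Fin (3 + 1) => lam' (itRoot Lc M (fun _ => ctrOff (3 + 1) Lc) (fun _ => hc) n a.1))
                  * compRowsSym Lc M lev rs n
                - compRowsSym Lc M lev rs n * Matrix.diagonal (fun b : ↥(pbox (towerTorus Lc M n)) × Fin (3 + 1) => lam' b.1))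
              * Matrix.diagonal (fun b : ↥(pbox (towerTorus Lc M n)) × Fin (3 + 1) => lam b.1)) := by
  rw [show (fun b : ↥(pbox (towerTorus Lc M n)) × Fin (3 + 1) =>
        h b + ∑ s : ↥(pbox (towerTorus Lc M n)), tgrad (towerTorus Lc M n) (b.1, Sum.inl b.2) s * lam s)
      = h + (fun b : ↥(pbox (towerTorus Lc M n)) × Fin (3 + 1) =>
        ∑ s : ↥(pbox (towerTorus Lc M n)), tgrad (towerTorus Lc M n) (b.1, Sum.inl b.2) s * lam s) from rfl,
    show (fun b : ↥(pbox (towerTorus Lc M n)) × Fin (3 + 1) =>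
        h' b + ∑ s : ↥(pbox (towerTorus Lc M n)), tgrad (towerTorus Lc M n) (b.1, Sum.inl b.2) s * lam' s)
      = h' + (fun b : ↥(pbox (towerTorus Lc M n)) × Fin (3 + 1) =>
        ∑ s : ↥(pbox (towerTorus Lc M n)), tgrad (towerTorus Lc M n) (b.1, Sum.inl b.2) s * lam' s) from rfl,
    compIns₂₂Sym_add_left, compIns₂₂Sym_add_right Lc hc, compIns₂₂Sym_add_right Lc hc, compIns₂₂Sym_pureGauge_snd Lc hc,
    compIns₂₂Sym_pureGauge_fst Lc hc, compIns₂₂Sym_pureGauge_pureGauge Lc hc]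
  abel

/-- [folklore] **`compIns₂Sym_pureGauge_shift` — (T-β-m)-Sym ORDER 2 ON THE DIAGONAL: THE SYM COMPOSITE SECOND-ORDER INSERTION JET ALONG A GAUGE-SHIFTED
DIRECTION, AT EVERY DEPTH** — leaf-02 g26's rooted `TorusCompositeIndexWardTwo.compIns₂_pureGauge_shift` VERBATIM under the (β1) substitution
(`compIns₂ ↦ compIns₂Sym`, `compIns₁ ↦ compIns₁Sym`, `compRows ↦ compRowsSym`, `itRoot … rs hrs ↦ itRoot … (fun _ => ctrOff 4 Lc) (fun _ => hc)`):
`compIns₂Sym … n (h + Dλ) = compIns₂Sym … n h + ((R·I₁ h − I₁ h·E) + (R·I₁ h − I₁ h·E)) + (R(R C − C E) − (R C − C E)E)` — NO constants: OUR ♭ sym composite second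
jet is EXACTLY gauge-covariant at order 2 (the polarised law on the diagonal, `compIns₂Sym = compIns₂₂Sym h h` by `rfl`). -/
theorem compIns₂Sym_pureGauge_shift (hc : ctrOff (3 + 1) Lc ∈ box (3 + 1) Lc) (n : ℕ) (M : Fin (3 + 1) → ℕ) [∀ μ, NeZero (M μ)] (lev : ℕ → ℕ)
    (rs : ℕ → (Fin (3 + 1) → ℕ)) (h : ↥(pbox (towerTorus Lc M n)) × Fin (3 + 1) → ℝ) (lam : ↥(pbox (towerTorus Lc M n)) → ℝ) :
    compIns₂Sym Lc M lev rs n (fun b : ↥(pbox (towerTorus Lc M n)) × Fin (3 + 1) =>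
        h b + ∑ s : ↥(pbox (towerTorus Lc M n)), tgrad (towerTorus Lc M n) (b.1, Sum.inl b.2) s * lam s)
      = compIns₂Sym Lc M lev rs n h
        + ((Matrix.diagonal (fun a : ↥(pbox M) × Fin (3 + 1) => lam (itRoot Lc M (fun _ => ctrOff (3 + 1) Lc) (fun _ => hc) n a.1))
                * compIns₁Sym Lc M lev rs n h
              - compIns₁Sym Lc M lev rs n h * Matrix.diagonal (fun b : ↥(pbox (towerTorus Lc M n)) × Fin (3 + 1) => lam b.1))
          + (Matrix.diagonal (fun a : ↥(pbox M) × Fin (3 + 1) => lam (itRoot Lc M (fun _ => ctrOff (3 + 1) Lc) (fun _ => hc) n a.1))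
                * compIns₁Sym Lc M lev rs n h
              - compIns₁Sym Lc M lev rs n h * Matrix.diagonal (fun b : ↥(pbox (towerTorus Lc M n)) × Fin (3 + 1) => lam b.1)))
        + (Matrix.diagonal (fun a : ↥(pbox M) × Fin (3 + 1) => lam (itRoot Lc M (fun _ => ctrOff (3 + 1) Lc) (fun _ => hc) n a.1))
              * (Matrix.diagonal (fun a : ↥(pbox M) × Fin (3 + 1) => lam (itRoot Lc M (fun _ => ctrOff (3 + 1) Lc) (fun _ => hc) n a.1))
                  * compRowsSym Lc M lev rs n
                - compRowsSym Lc M lev rs n * Matrix.diagonal (fun b : ↥(pbox (towerTorus Lc M n)) × Fin (3 + 1) => lam b.1))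
            - (Matrix.diagonal (fun a : ↥(pbox M) × Fin (3 + 1) => lam (itRoot Lc M (fun _ => ctrOff (3 + 1) Lc) (fun _ => hc) n a.1))
                  * compRowsSym Lc M lev rs n
                - compRowsSym Lc M lev rs n * Matrix.diagonal (fun b : ↥(pbox (towerTorus Lc M n)) × Fin (3 + 1) => lam b.1))
              * Matrix.diagonal (fun b : ↥(pbox (towerTorus Lc M n)) × Fin (3 + 1) => lam b.1)) := by
  rw [compIns₂Sym, compIns₂Sym, compIns₂₂Sym_pureGauge_shift Lc hc]
  abel

end Tower

end Summit.QuantumFields.BalabanUV.Beta.FP.TorusCompositeIndexWardTwoSym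

end
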